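import Literature.MathematicalPhysics.QuantumLattice.PairCorrelations
import Literature.MathematicalPhysics.QuantumLattice.NagaokaTasakiProofs
import Literature.Probability.LatticeModels.ThermodynamicLimit
import HarnessLib

/-!
# The (partially) Gutzwiller-projected, number-projected `d`-wave BCS trial state on the torus

Trunk T-QLATTICE (`Literature/MathematicalPhysics/QuantumLattice`); definition request
`defn-projectedBCSState` (route HubbardSuperconductivity/ProjectedBCSGas, items
`stmt-HubbardSuperconductivity-1233..1236`, where the state is inlined verbatim as a `let`-chain).

Anderson's RVB / Paramekanti–Randeria–Trivedi trial state for the square-lattice Hubbard model is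
the Gutzwiller-projected `d`-wave BCS state (Paramekanti–Randeria–Trivedi 2004, §IV eq. (6)):
`|Ψ₀⟩ = e^{-iS} P |Ψ_BCS⟩`, `|Ψ_BCS⟩ = (Σ_k φ(k) c†_{k↑} c†_{-k↓})^{N/2} |0⟩`,
`φ(k) = v_k/u_k = Δ_k / (ξ_k + √(ξ_k² + Δ_k²))`, `ξ_k = ε(k) - μ_var`,
`Δ_k = Δ_var (cos k_x - cos k_y)/2`, `P = Π_r (1 - n_{r↑} n_{r↓})`; by their footnote 31 the
fixed-`N` state is (up to normalisation) the `N`-particle projection of the "fixed phase" BCS state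
`Π_k (1 + φ(k) c†_{k↑} c†_{-k↓}) |0⟩ ∝ Π_k (u_k + v_k c†_{k↑} c†_{-k↓}) |0⟩`. The PARTIALLY projected
("gossamer", Laughlin 2002) family replaces `P` by `Π_r [1 - (1 - g) n_{r↑} n_{r↓}]`, `0 ≤ g ≤ 1`
(ibid. §IV, p. 5 of the eprint), i.e. the diagonal weight `g^{#doubly occupied sites}`
(`g = 0`: full projection, `g = 1`: no projection).

## Contents (tree vocabulary of `HubbardWave0` / `HubbardModel` / `NagaokaTasaki`)

* `fockNormalize ψ = (√(re ⟨ψ, ψ⟩))⁻¹ • ψ` (junk `0` for `ψ = 0`), `numberProj N` (the projector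
  `P_N` on the `N`-particle sector), `doublonCount s`, the partial Gutzwiller projector
  `gutzwillerWeight g = diag (g^{doublonCount s})` with `gutzwillerWeight 0 = gutzwillerProj`,
  and the combined diagonal weight `projWeight g N s = [#s = N] g^{doublonCount s}`.
* On the fermionic torus `FermionTorus 2 L` (momenta `k = 2πn/L`, `n ∈ FermionTorus 2 L`), in
  the sub-namespace `ProjectedBCS`: `cosMomentum`, the band energy `bandXi μ` (`t = 1`,
  `ξ_k = -2(cos k₁ + cos k₂) - μ`), the `d_{x²-y²}` gap `gapDelta Δv` (`Δ_k = Δv (cos k₁ - cos k₂)`),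
  `bogoliubovE = √(ξ² + Δ²)`, the coherence factors `cohU = √((1 + ξ/E)/2)`,
  `cohV = sgn(Δ) √((1 - ξ/E)/2)`, the pair creation operator
  `pairCreation L n = c†_{k↑} c†_{-k↓} = L⁻² Σ_{x,y} e^{ik·(x-y)} c†_{x↑} c†_{y↓}` written in position
  space, the Bogoliubov factors `bogoliubovFactor = u_k • 1 + v_k • c†_{k↑} c†_{-k↓}` and the
  fixed-phase BCS state `bcsState L Δv μ = Π_k (u_k + v_k c†_{k↑} c†_{-k↓}) |0⟩`.
* `projectedBCSState g Δv μ L N = fockNormalize (s ↦ projWeight g N s · bcsState L Δv μ s)`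
  `= normalise (P_g P_N |BCS⟩)` — DEFINITIONALLY equal (`rfl`, see `projectedBCSState_eq`) to the
  `let`-chain inlined in the route decls `ProjectedBCSPairLRO`, `RVBShadowing`,
  `UnprojectedBCSPairLRO`, `GossamerWindowPairLRO` of
  `Summits/HubbardSuperconductivity/HubbardSuperconductivity/Theses/ProjectedBCSGas.lean` with
  `N := 2 ⌊(1 - δ) L²/2⌋₊`, so that e.g.
  `example : ProjectedBCSPairLRO ↔ ∀ g ∈ Set.Icc (0:ℝ) 1, …, a ≤ pairFieldCorr dWaveFormFactor
     (fun L => projectedBCSState g Δv μ L (2 * ⌊(1 - δ) * (L : ℝ) ^ 2 / 2⌋₊)) L x y := Iff.rfl`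
  elaborates (checked against a verbatim copy of the route terms, 2026-08-15).
* API: `isNParticle_projectedBCSState`, `spinZ_mulVec_projectedBCSState` (`S^z = 0`),
  `projectedBCSState_mem_szSector` (the `(N, S^z = 0)` sector of `IsGroundStateInSector`),
  `isGutzwiller_projectedBCSState_zero` (`g = 0`), `projectedBCSState_eq_fockNormalize`
  (operator form `normalise (gutzwillerWeight g *ᵥ numberProj N *ᵥ bcsState)`) with the corners
  `projectedBCSState_one_eq` (`g = 1`: `normalise (P_N |BCS⟩)`) and `projectedBCSState_zero_eq`
  (`g = 0`: `normalise (gutzwillerProj *ᵥ P_N |BCS⟩)`), `star_fockNormalize_dotProduct` /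
  `star_projectedBCSState_dotProduct` (unit norm whenever the raw vector is nonzero).
* Instance note for users at concrete lattices: Mathlib's `Pi.Lex.linearOrder` decides equality
  classically, so the order-derived `DecidableEq (Orb (FermionTorus 2 L))` differs (as a term) from
  the structural `Lex/Prod/Pi/Fin` instance that elaboration finds at the concrete type; lemmas here
  that expose such an instance (`numberProj`, `projWeight_mul_eq_mulVec`, `list_prod_map_mulVec_mem`)
  take it as their own binder so that they rewrite concrete terms.

## Design notes

* Faithfulness to the route: the parametrisation is the route's (`t = 1`, gap amplitude
  `Δv = Δ_var/2` of PRT, `v_k` carrying the sign of `Δ_k` so that `v_k/u_k = Δ_k/(ξ_k + E_k)` as in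
  PRT eq. (6)), no `e^{-iS}` dressing (the route's family is the plainly projected state), and the
  product form `P_N Π_k (u_k + v_k b_k)|0⟩ = (Π_k u_k) · (N/2)!⁻¹ (Σ_k φ(k) b_k)^{N/2} |0⟩`, which is
  PRT's state up to a positive factor whenever all `u_k > 0` and is regular where `φ` is singular.
* `doublonCount` is written with the classical decidability instance
  (`fun _ => Classical.propDecidable _`) ON PURPOSE: the route file elaborates its inlined
  `Finset.univ.filter (fun x => orb x 0 ∈ s ∧ orb x 1 ∈ s)` under `open scoped Classical` to exactly
  this instance, and definitional equality with the route decls requires the same term;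
  `doublonCount_eq_card_filter` restates it for an arbitrary instance.
* Junk values (documented, irrelevant along `L → ∞`): `E_k = 0` (only if `ξ_k = Δ_k = 0`) gives
  `ξ/E = 0/0 = 0` and `u_k = |v_k| = 1/√2`; `L = 0` divides by zero inside `cos`; `fockNormalize 0 = 0`.
* NOT here: non-vanishing of `P_g P_N |BCS⟩` (needs `N` even, enough momenta with `u_k v_k ≠ 0` —
  `L ≥ 8` in the route's window — and, at `g = 0`, a genuine RVB amplitude computation), Wick /
  Pfaffian structure at `g = 1`, any correlation estimate: route work.

## Sources

* A. Paramekanti, M. Randeria, N. Trivedi, *High-`T_c` superconductors: a variational theory of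
  the superconducting state*, Phys. Rev. B 70 (2004) 054504 = arXiv:cond-mat/0305611, §IV
  eq. (6)–(7), footnote 31, and p. 5 (partially projected Gutzwiller wavefunction).
* C. Gros, *Physics of projected wavefunctions*, Ann. Phys. 189 (1989) 53; F. C. Zhang, C. Gros,
  T. M. Rice, H. Shiba, Supercond. Sci. Technol. 1 (1988) 36 (Gutzwiller-projected BCS = RVB).
* R. B. Laughlin, *Gossamer superconductivity*, arXiv:cond-mat/0209269 (partial projection).
* J. Bardeen, L. N. Cooper, J. R. Schrieffer, Phys. Rev. 108 (1957) 1175 (coherence factors).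
-/

noncomputable section

namespace Literature.MathematicalPhysics.QuantumLattice

open Matrix Finset

/-! ### Normalisation of Fock vectors -/

section Normalize

variable {ι : Type*} [Fintype ι]

/-- The normalised vector `‖ψ‖⁻¹ ψ = (√(re ⟨ψ, ψ⟩))⁻¹ • ψ` of a Fock vector (`⟨ψ, ψ⟩ = star ψ ⬝ᵥ ψ`
as everywhere in the tree); junk value `0` for `ψ = 0` (`0⁻¹ = 0`). Written exactly as in the
route ProjectedBCSGas (`normalise`). [folklore] -/
def fockNormalize (ψ : Fock ι) : Fock ι :=
  (((Real.sqrt ((star ψ ⬝ᵥ ψ).re))⁻¹ : ℝ) : ℂ) • ψ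

/-- `fockNormalize` unfolded. [folklore] -/
theorem fockNormalize_def (ψ : Fock ι) :
    fockNormalize ψ = (((Real.sqrt ((star ψ ⬝ᵥ ψ).re))⁻¹ : ℝ) : ℂ) • ψ := rfl

/-- Components of the normalised vector. [folklore] -/
theorem fockNormalize_apply (ψ : Fock ι) (s : Finset ι) :
    fockNormalize ψ s = (((Real.sqrt ((star ψ ⬝ᵥ ψ).re))⁻¹ : ℝ) : ℂ) * ψ s := rfl

/-- Normalising the zero vector gives the zero vector (junk value). [folklore] -/
@[simp] theorem fockNormalize_zero : fockNormalize (0 : Fock ι) = 0 := by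
  simp [fockNormalize]

/-- Normalisation does not enlarge the support. [folklore] -/
theorem fockNormalize_apply_eq_zero {ψ : Fock ι} {s : Finset ι} (h : ψ s = 0) :
    fockNormalize ψ s = 0 := by
  rw [fockNormalize_apply, h, mul_zero]

/-- `⟨ψ, ψ⟩ = Σ_s |ψ s|²` (a real number). [folklore] -/
theorem star_dotProduct_self_eq_sum_normSq (ψ : Fock ι) :
    star ψ ⬝ᵥ ψ = ((∑ s, Complex.normSq (ψ s) : ℝ) : ℂ) := by
  simp only [dotProduct, Pi.star_apply, Complex.star_def, Complex.normSq_eq_conj_mul_self,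
    Complex.ofReal_sum]

/-- `⟨ψ, ψ⟩ > 0` for `ψ ≠ 0`. [folklore] -/
theorem sum_normSq_pos {ψ : Fock ι} (hψ : ψ ≠ 0) : 0 < ∑ s, Complex.normSq (ψ s) := by
  obtain ⟨s, hs⟩ : ∃ s, ψ s ≠ 0 := Function.ne_iff.mp hψ
  exact lt_of_lt_of_le (Complex.normSq_pos.2 hs)
    (Finset.single_le_sum (fun t _ => Complex.normSq_nonneg (ψ t)) (Finset.mem_univ s))

/-- The normalised vector of a nonzero vector has unit norm: `⟨ψ̂, ψ̂⟩ = 1`. [folklore] -/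
theorem star_fockNormalize_dotProduct {ψ : Fock ι} (hψ : ψ ≠ 0) :
    star (fockNormalize ψ) ⬝ᵥ fockNormalize ψ = 1 := by
  have hpos := sum_normSq_pos hψ
  have hq := star_dotProduct_self_eq_sum_normSq ψ
  unfold fockNormalize
  rw [hq, Complex.ofReal_re, star_smul, smul_dotProduct, dotProduct_smul, hq]
  simp only [smul_eq_mul, Complex.star_def, Complex.conj_ofReal]
  rw [← Complex.ofReal_mul, ← Complex.ofReal_mul, ← Complex.ofReal_one, Complex.ofReal_inj,
    ← mul_assoc, ← mul_inv, Real.mul_self_sqrt hpos.le, inv_mul_cancel₀ hpos.ne']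

end Normalize

/-! ### Number projection and the partial Gutzwiller projector (general lattice) -/

section Projections

variable {ι : Type*} [DecidableEq ι]

/-- The projector `P_N` on the `N`-particle sector: the diagonal matrix `[#s = N]` in the
occupation basis. [Paramekanti–Randeria–Trivedi 2004, footnote 31 ("the `N`-particle projection")]
[cite: ParamekantiRanderiaTrivedi2004, §IV footnote 31] -/
def numberProj (N : ℕ) : Matrix (Finset ι) (Finset ι) ℂ :=
  Matrix.diagonal fun s => if s.card = N then 1 else 0

variable [Fintype ι]

/-- Components of `P_N ψ`. [folklore] -/
theorem numberProj_mulVec_apply (N : ℕ) (ψ : Fock ι) (s : Finset ι) :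
    (numberProj N *ᵥ ψ) s = if s.card = N then ψ s else 0 := by
  rw [numberProj, mulVec_diagonal]
  split_ifs <;> simp

/-- `P_N ψ` lies in the `N`-particle sector. [folklore] -/
theorem isNParticle_numberProj_mulVec (N : ℕ) (ψ : Fock ι) :
    IsNParticle N (numberProj N *ᵥ ψ) := fun s hs => by
  rw [numberProj_mulVec_apply, if_neg hs]

/-- `P_N` fixes exactly the `N`-particle vectors. [folklore] -/
theorem numberProj_mulVec_eq_self_iff (N : ℕ) (ψ : Fock ι) :
    numberProj N *ᵥ ψ = ψ ↔ IsNParticle N ψ := by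
  constructor
  · intro h s hs
    have := congrFun h s
    rw [numberProj_mulVec_apply, if_neg hs] at this
    exact this.symm
  · intro h
    funext s
    rw [numberProj_mulVec_apply]
    by_cases hs : s.card = N
    · rw [if_pos hs]
    · rw [if_neg hs, h s hs]

variable {Λ : Type*} [LinearOrder Λ] [Fintype Λ]

/-- The number of doubly occupied sites `D(s) = #{x | (x,↑) ∈ s ∧ (x,↓) ∈ s}` of an occupation set.
The filter is taken with the classical decidability instance on purpose (see the module docstring:
this is the term the route ProjectedBCSGas elaborates to); `doublonCount_eq_card_filter` gives it
for any instance. [Paramekanti–Randeria–Trivedi 2004, §IV (double occupancy `n_{r↑} n_{r↓}`)]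
[cite: ParamekantiRanderiaTrivedi2004, §IV] -/
def doublonCount (s : Finset (Orb Λ)) : ℕ :=
  (@Finset.filter Λ (fun x => orb x 0 ∈ s ∧ orb x 1 ∈ s) (fun _ => Classical.propDecidable _)
    Finset.univ).card

omit [LinearOrder Λ] in
/-- `doublonCount` with an arbitrary decidability instance. [folklore] -/
theorem doublonCount_eq_card_filter (s : Finset (Orb Λ))
    [DecidablePred fun x : Λ => orb x 0 ∈ s ∧ orb x 1 ∈ s] :
    doublonCount s = (Finset.univ.filter fun x : Λ => orb x 0 ∈ s ∧ orb x 1 ∈ s).card := by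
  unfold doublonCount
  congr 1
  exact Finset.filter_congr_decidable _ _ _

/-- No doubly occupied site iff the Gutzwiller (no-double-occupancy) constraint holds. [folklore] -/
theorem doublonCount_eq_zero_iff (s : Finset (Orb Λ)) :
    doublonCount s = 0 ↔ ¬ HasDoubleOccupancy s := by
  rw [doublonCount_eq_card_filter, Finset.card_eq_zero, Finset.filter_eq_empty_iff,
    HasDoubleOccupancy, not_exists]
  simp only [Finset.mem_univ, true_implies]

/-- The PARTIAL Gutzwiller projector `Π_r [1 - (1 - g) n_{r↑} n_{r↓}]`, i.e. the diagonal weight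
`g^{D(s)}` on `|s⟩` (`0^0 = 1`): `g = 0` is the full Gutzwiller projector, `g = 1` the identity,
`0 < g < 1` Laughlin's "gossamer" partial projection. [Paramekanti–Randeria–Trivedi 2004, §IV,
p. 5 of arXiv:cond-mat/0305611 (partially projected Gutzwiller wavefunction, after Laughlin
cond-mat/0209269)] [cite: ParamekantiRanderiaTrivedi2004, §IV] -/
def gutzwillerWeight (g : ℝ) : Matrix (Finset (Orb Λ)) (Finset (Orb Λ)) ℂ :=
  Matrix.diagonal fun s => (g : ℂ) ^ doublonCount s

/-- Components of the partially projected vector. [folklore] -/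
theorem gutzwillerWeight_mulVec_apply (g : ℝ) (ψ : Fock (Orb Λ)) (s : Finset (Orb Λ)) :
    (gutzwillerWeight g *ᵥ ψ) s = (g : ℂ) ^ doublonCount s * ψ s := by
  rw [gutzwillerWeight, mulVec_diagonal]

/-- At `g = 0` the partial projector is the Gutzwiller projector of `NagaokaTasaki`. [folklore] -/
theorem gutzwillerWeight_zero :
    (gutzwillerWeight 0 : Matrix (Finset (Orb Λ)) (Finset (Orb Λ)) ℂ) = gutzwillerProj := by
  rw [gutzwillerWeight, gutzwillerProj]
  congr 1
  funext s
  rw [Complex.ofReal_zero, zero_pow_eq]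
  by_cases h : HasDoubleOccupancy s
  · rw [if_pos h, if_neg (mt (doublonCount_eq_zero_iff s).1 (not_not.2 h))]
  · rw [if_neg h, if_pos ((doublonCount_eq_zero_iff s).2 h)]

/-- At `g = 1` the partial projector acts as the identity (no projection); stated through its
action, which does not expose the `DecidableEq` instance hidden in `(1 : Matrix _ _ ℂ)`. [folklore] -/
theorem gutzwillerWeight_one_mulVec (ψ : Fock (Orb Λ)) : gutzwillerWeight 1 *ᵥ ψ = ψ := by
  funext s
  rw [gutzwillerWeight_mulVec_apply, Complex.ofReal_one, one_pow, one_mul]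

/-- The combined diagonal weight of `P_g P_N` on `|s⟩`: `[#s = N] · g^{D(s)}`.
[Paramekanti–Randeria–Trivedi 2004, §IV] [cite: ParamekantiRanderiaTrivedi2004, §IV] -/
def projWeight (g : ℝ) (N : ℕ) (s : Finset (Orb Λ)) : ℂ :=
  if s.card = N then (g : ℂ) ^ doublonCount s else 0

/-- Multiplying amplitudes by `projWeight g N` is applying `P_g P_N` (stated for an arbitrary
`DecidableEq (Orb Λ)` instance feeding `numberProj`, so that it rewrites at concrete lattices, whose
instance need not be the order-derived one). [folklore] -/
theorem projWeight_mul_eq_mulVec [DecidableEq (Orb Λ)] (g : ℝ) (N : ℕ) (ψ : Fock (Orb Λ)) :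
    (fun s => projWeight g N s * ψ s) = gutzwillerWeight g *ᵥ (numberProj N *ᵥ ψ) := by
  funext s
  rw [gutzwillerWeight_mulVec_apply, numberProj_mulVec_apply, projWeight]
  split_ifs <;> simp

end Projections

/-! ### Spin balance: vectors supported on configurations with `N↑ = N↓` -/

/-- `(0 : Fin 2) ≠ 1` (spin up ≠ spin down). [folklore] -/
private theorem fin_zero_ne_one : (0 : Fin 2) ≠ 1 := by decide

section Balanced

variable {Λ : Type*} [LinearOrder Λ] [Fintype Λ]

/-- The subspace of Fock vectors supported on occupation sets with as many up as down spins
(`upCount s = downCount s`); on it `S^z = 0`. [folklore] -/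
def spinBalanced : Submodule ℂ (Fock (Orb Λ)) where
  carrier := {ψ | ∀ s, upCount s ≠ NagaokaTasaki.downCount s → ψ s = 0}
  add_mem' {ψ φ} hψ hφ s hs := by simp [Pi.add_apply, hψ s hs, hφ s hs]
  zero_mem' _ _ := rfl
  smul_mem' a ψ hψ s hs := by simp [hψ s hs]

/-- Membership in `spinBalanced`, unfolded. [folklore] -/
theorem mem_spinBalanced_iff (ψ : Fock (Orb Λ)) :
    ψ ∈ spinBalanced ↔ ∀ s, upCount s ≠ NagaokaTasaki.downCount s → ψ s = 0 := Iff.rfl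

/-- `S^z ψ = 0` on spin-balanced vectors. [folklore] -/
theorem spinZ_mulVec_eq_zero_of_mem_spinBalanced {ψ : Fock (Orb Λ)} (hψ : ψ ∈ spinBalanced) :
    HubbardWave0.spinZ *ᵥ ψ = 0 := by
  funext s
  rw [NagaokaTasaki.spinZ_mulVec_apply, Pi.zero_apply]
  by_cases h : upCount s = NagaokaTasaki.downCount s
  · rw [h, sub_self, mul_zero, zero_mul]
  · rw [hψ s h, mul_zero]

/-- A vector whose support is contained in that of a spin-balanced vector is spin-balanced.
[folklore] -/
theorem mem_spinBalanced_of_support {ψ φ : Fock (Orb Λ)} (hψ : ψ ∈ spinBalanced)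
    (h : ∀ s, ψ s = 0 → φ s = 0) : φ ∈ spinBalanced := fun s hs => h s (hψ s hs)

/-- The vacuum is spin-balanced. [folklore] -/
theorem vacuum_mem_spinBalanced : (vacuum : Fock (Orb Λ)) ∈ spinBalanced := by
  intro s hs
  have hne : s ≠ ∅ := by
    rintro rfl
    simp [upCount, NagaokaTasaki.downCount] at hs
  simp [vacuum, hne]

/-- The action of `c†_i` on amplitudes: `(c†_i f)(s) = [i ∈ s] σ_i(s ∖ i) f(s ∖ i)`. [folklore] -/
private theorem creation_mulVec_apply_aux (i : Orb Λ) (f : Fock (Orb Λ))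
    (s : Finset (Orb Λ)) :
    (creation i *ᵥ f) s = if i ∈ s then jwSign i (s.erase i) * f (s.erase i) else 0 := by
  simp only [mulVec, dotProduct, creation_apply]
  by_cases hi : i ∈ s
  · rw [if_pos hi, Finset.sum_eq_single (s.erase i)]
    · rw [if_pos ⟨Finset.notMem_erase i s, (Finset.insert_erase hi).symm⟩]
    · intro t _ ht
      rw [if_neg, zero_mul]
      rintro ⟨hit, rfl⟩
      exact ht (Finset.erase_insert hit).symm
    · intro h; exact absurd (Finset.mem_univ _) h
  · rw [if_neg hi]
    refine Finset.sum_eq_zero fun t _ => ?_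
    rw [if_neg, zero_mul]
    rintro ⟨-, rfl⟩
    exact hi (Finset.mem_insert_self i t)

/-- Removing an up electron lowers `N↑` by one. [folklore] -/
theorem upCount_erase_orb_zero {s : Finset (Orb Λ)} {x : Λ} (h : orb x 0 ∈ s) :
    upCount (s.erase (orb x 0)) + 1 = upCount s := by
  unfold upCount
  have : (Finset.univ.filter fun z : Λ => orb z 0 ∈ s.erase (orb x 0)) =
      (Finset.univ.filter fun z : Λ => orb z 0 ∈ s).erase x := by
    ext z
    simp only [Finset.mem_filter, Finset.mem_univ, true_and, Finset.mem_erase, orb_eq_orb_iff,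
      and_true, ne_eq]
  rw [this, Finset.card_erase_add_one]
  simpa using h

/-- Removing a down electron does not change `N↑`. [folklore] -/
theorem upCount_erase_orb_one (s : Finset (Orb Λ)) (y : Λ) :
    upCount (s.erase (orb y 1)) = upCount s := by
  unfold upCount
  congr 1
  ext z
  simp only [Finset.mem_filter, Finset.mem_univ, true_and, Finset.mem_erase, orb_eq_orb_iff,
    ne_eq, fin_zero_ne_one, and_false, not_false_eq_true]

/-- Removing a down electron lowers `N↓` by one. [folklore] -/
theorem downCount_erase_orb_one {s : Finset (Orb Λ)} {y : Λ} (h : orb y 1 ∈ s) :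
    NagaokaTasaki.downCount (s.erase (orb y 1)) + 1 = NagaokaTasaki.downCount s := by
  unfold NagaokaTasaki.downCount
  have : (Finset.univ.filter fun z : Λ => orb z 1 ∈ s.erase (orb y 1)) =
      (Finset.univ.filter fun z : Λ => orb z 1 ∈ s).erase y := by
    ext z
    simp only [Finset.mem_filter, Finset.mem_univ, true_and, Finset.mem_erase, orb_eq_orb_iff,
      and_true, ne_eq]
  rw [this, Finset.card_erase_add_one]
  simpa using h

/-- Removing an up electron does not change `N↓`. [folklore] -/
theorem downCount_erase_orb_zero (s : Finset (Orb Λ)) (x : Λ) :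
    NagaokaTasaki.downCount (s.erase (orb x 0)) = NagaokaTasaki.downCount s := by
  unfold NagaokaTasaki.downCount
  congr 1
  ext z
  simp only [Finset.mem_filter, Finset.mem_univ, true_and, Finset.mem_erase, orb_eq_orb_iff,
    ne_eq, fin_zero_ne_one.symm, and_false, not_false_eq_true]

/-- Creating one up and one down electron preserves spin balance. [folklore] -/
theorem creation_up_mul_creation_down_mulVec_mem_spinBalanced (x y : Λ) {ψ : Fock (Orb Λ)}
    (hψ : ψ ∈ spinBalanced) :
    (creation (orb x 0) * creation (orb y 1)) *ᵥ ψ ∈ spinBalanced := by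
  intro t ht
  rw [← mulVec_mulVec, creation_mulVec_apply_aux]
  by_cases hx : orb x 0 ∈ t
  · rw [if_pos hx, creation_mulVec_apply_aux]
    by_cases hy : orb y 1 ∈ t.erase (orb x 0)
    · rw [if_pos hy, hψ _ _, mul_zero, mul_zero]
      intro hbal
      apply ht
      have hy' : orb y 1 ∈ t := Finset.mem_of_mem_erase hy
      have h1 := upCount_erase_orb_zero hx
      have h2 := downCount_erase_orb_one hy
      rw [upCount_erase_orb_one] at hbal
      rw [downCount_erase_orb_zero] at h2
      omega
    · rw [if_neg hy, mul_zero]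
  · rw [if_neg hx]

/-- Iterating balance-preserving operators along a list preserves spin balance (used for the
product `Π_k (u_k + v_k c†_{k↑} c†_{-k↓})`). [folklore] -/
theorem list_prod_map_mulVec_mem {n : Type*} [Fintype n] [DecidableEq n] {κ : Type*}
    (S : Submodule ℂ (n → ℂ)) (f : κ → Matrix n n ℂ) (hf : ∀ k, ∀ ψ ∈ S, f k *ᵥ ψ ∈ S) :
    ∀ (l : List κ) (ψ : n → ℂ), ψ ∈ S → (l.map f).prod *ᵥ ψ ∈ S
  | [], ψ, hψ => by simpa using hψ
  | k :: l, ψ, hψ => by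
    rw [List.map_cons, List.prod_cons, ← mulVec_mulVec]
    exact hf k _ (list_prod_map_mulVec_mem S f hf l ψ hψ)

end Balanced

/-! ### The `d`-wave BCS data on the torus `(ℤ/Lℤ)²` -/

namespace ProjectedBCS

variable (L : ℕ)

/-- `cos k_i` for the torus momentum `k = 2πn/L`, `n ∈ FermionTorus 2 L` (components
`n_i ∈ {0, …, L-1}` read through `ofLex`). [Paramekanti–Randeria–Trivedi 2004, §IV (dispersion
`ε(k)` and gap on the square lattice)] [cite: ParamekantiRanderiaTrivedi2004, §IV] -/
def cosMomentum (n : FermionTorus 2 L) (i : Fin 2) : ℝ :=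
  Real.cos (2 * Real.pi * ((ofLex n i : ℕ) : ℝ) / L)

/-- The band energy measured from the chemical potential, `ξ_k = ε(k) - μ = -2(cos k₁ + cos k₂) - μ`
(nearest-neighbour hopping `t = 1`, `t' = 0`). [Paramekanti–Randeria–Trivedi 2004, §IV
(`ξ_k = ε(k) - μ_var`)] [cite: ParamekantiRanderiaTrivedi2004, §IV eq. (6)] -/
def bandXi (μ : ℝ) (n : FermionTorus 2 L) : ℝ :=
  -2 * (cosMomentum L n 0 + cosMomentum L n 1) - μ

/-- The `d_{x²-y²}` gap function `Δ_k = Δv (cos k₁ - cos k₂)` (PRT write `Δ_var (cos k_x - cos k_y)/2`,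
so `Δv = Δ_var/2`). [Paramekanti–Randeria–Trivedi 2004, §IV] [cite: ParamekantiRanderiaTrivedi2004, §IV eq. (6)] -/
def gapDelta (Δv : ℝ) (n : FermionTorus 2 L) : ℝ :=
  Δv * (cosMomentum L n 0 - cosMomentum L n 1)

/-- The Bogoliubov quasiparticle energy `E_k = √(ξ_k² + Δ_k²)`. [Paramekanti–Randeria–Trivedi 2004,
§IV] [cite: ParamekantiRanderiaTrivedi2004, §IV eq. (6)] -/
def bogoliubovE (Δv μ : ℝ) (n : FermionTorus 2 L) : ℝ :=
  Real.sqrt (bandXi L μ n ^ 2 + gapDelta L Δv n ^ 2)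

/-- The BCS coherence factor `u_k = √((1 + ξ_k/E_k)/2)` (Bardeen–Cooper–Schrieffer 1957); junk
value `1/√2` at `E_k = 0` (`0/0 = 0`). [Paramekanti–Randeria–Trivedi 2004, §IV (`φ = v_k/u_k`)]
[cite: ParamekantiRanderiaTrivedi2004, §IV eq. (6)] -/
def cohU (Δv μ : ℝ) (n : FermionTorus 2 L) : ℝ :=
  Real.sqrt ((1 + bandXi L μ n / bogoliubovE L Δv μ n) / 2)

/-- The BCS coherence factor `v_k = sgn(Δ_k) √((1 - ξ_k/E_k)/2)` (sign convention `sgn 0 = 1`), so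
that `v_k/u_k = Δ_k/(ξ_k + E_k) = φ(k)` of PRT. [Paramekanti–Randeria–Trivedi 2004, §IV
(`φ(k) = v_k/u_k = Δ_k/[ξ_k + √(ξ_k² + Δ_k²)]`)] [cite: ParamekantiRanderiaTrivedi2004, §IV eq. (6)] -/
def cohV (Δv μ : ℝ) (n : FermionTorus 2 L) : ℝ :=
  (if 0 ≤ gapDelta L Δv n then 1 else -1) *
    Real.sqrt ((1 - bandXi L μ n / bogoliubovE L Δv μ n) / 2)

/-- The phase `k · x = 2π (n₀ x₀ + n₁ x₁)/L` of the plane wave `e^{ik·x}`, `k = 2πn/L`.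
[folklore] -/
def phase (n x : FermionTorus 2 L) : ℝ :=
  2 * Real.pi *
    (((ofLex n 0 : ℕ) * (ofLex x 0 : ℕ) + (ofLex n 1 : ℕ) * (ofLex x 1 : ℕ) : ℕ) : ℝ) / L

/-- The Cooper-pair creation operator `b_k = c†_{k↑} c†_{-k↓} = L⁻² Σ_{x,y} e^{ik·(x-y)} c†_{x↑} c†_{y↓}`
(`c†_{kσ} = L⁻¹ Σ_x e^{ik·x} c†_{xσ}`), written in the position-space Jordan–Wigner operators of
`HubbardWave0`. [Paramekanti–Randeria–Trivedi 2004, §IV eq. (6) (`c†_{k↑} c†_{-k↓}`)]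
[cite: ParamekantiRanderiaTrivedi2004, §IV eq. (6)] -/
def pairCreation (n : FermionTorus 2 L) :
    Matrix (Finset (Orb (FermionTorus 2 L))) (Finset (Orb (FermionTorus 2 L))) ℂ :=
  ∑ x : FermionTorus 2 L, ∑ y : FermionTorus 2 L,
    (Complex.exp (Complex.I * ((phase L n x - phase L n y : ℝ) : ℂ)) / (L : ℂ) ^ 2) •
      (creation (orb x 0) * creation (orb y 1))

/-- The Bogoliubov factor `u_k + v_k c†_{k↑} c†_{-k↓}` of the fixed-phase BCS product state.
[Paramekanti–Randeria–Trivedi 2004, footnote 31 (`Π_k (1 + φ(k) c†_{k↑} c†_{-k↓})`)]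
[cite: ParamekantiRanderiaTrivedi2004, §IV footnote 31] -/
def bogoliubovFactor (Δv μ : ℝ) (n : FermionTorus 2 L) :
    Matrix (Finset (Orb (FermionTorus 2 L))) (Finset (Orb (FermionTorus 2 L))) ℂ :=
  ((cohU L Δv μ n : ℝ) : ℂ) •
      (1 : Matrix (Finset (Orb (FermionTorus 2 L))) (Finset (Orb (FermionTorus 2 L))) ℂ) +
    ((cohV L Δv μ n : ℝ) : ℂ) • pairCreation L n

/-- The (unnormalised, grand-canonical, fixed-phase) `d`-wave BCS state on the torus of side `L`,
`|BCS⟩ = Π_k (u_k + v_k c†_{k↑} c†_{-k↓}) |0⟩ = (Π_k u_k) · Π_k (1 + φ(k) c†_{k↑} c†_{-k↓}) |0⟩`, the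
product over all `L²` momenta taken along `Finset.univ.toList` (the factors commute, being even
in the fermions). [Paramekanti–Randeria–Trivedi 2004, §IV eq. (6) and footnote 31]
[cite: ParamekantiRanderiaTrivedi2004, §IV footnote 31] -/
def bcsState (Δv μ : ℝ) : Fock (Orb (FermionTorus 2 L)) :=
  ((Finset.univ : Finset (FermionTorus 2 L)).toList.map (bogoliubovFactor L Δv μ)).prod *ᵥ vacuum

variable {L}

/-- `b_k` preserves spin balance (it creates one up and one down electron). [folklore] -/
theorem pairCreation_mulVec_mem_spinBalanced (n : FermionTorus 2 L)
    {ψ : Fock (Orb (FermionTorus 2 L))} (hψ : ψ ∈ spinBalanced) :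
    pairCreation L n *ᵥ ψ ∈ spinBalanced := by
  rw [pairCreation, sum_mulVec]
  refine Submodule.sum_mem _ fun x _ => ?_
  rw [sum_mulVec]
  refine Submodule.sum_mem _ fun y _ => ?_
  rw [smul_mulVec]
  exact Submodule.smul_mem _ _ (creation_up_mul_creation_down_mulVec_mem_spinBalanced x y hψ)

/-- Each Bogoliubov factor preserves spin balance. [folklore] -/
theorem bogoliubovFactor_mulVec_mem_spinBalanced (Δv μ : ℝ) (n : FermionTorus 2 L)
    {ψ : Fock (Orb (FermionTorus 2 L))} (hψ : ψ ∈ spinBalanced) :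
    bogoliubovFactor L Δv μ n *ᵥ ψ ∈ spinBalanced := by
  rw [bogoliubovFactor, add_mulVec, smul_mulVec, smul_mulVec, one_mulVec]
  exact Submodule.add_mem _ (Submodule.smul_mem _ _ hψ)
    (Submodule.smul_mem _ _ (pairCreation_mulVec_mem_spinBalanced n hψ))

variable (L) in
/-- The BCS product state is spin-balanced (`N↑ = N↓` on its support). [folklore] -/
theorem bcsState_mem_spinBalanced (Δv μ : ℝ) : bcsState L Δv μ ∈ spinBalanced := by
  unfold bcsState
  exact list_prod_map_mulVec_mem spinBalanced (bogoliubovFactor L Δv μ)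
    (fun n _ hψ => bogoliubovFactor_mulVec_mem_spinBalanced Δv μ n hψ) _ vacuum
    vacuum_mem_spinBalanced

end ProjectedBCS

/-! ### The projected trial state -/

/-- **The (partially) Gutzwiller-projected, number-projected `d`-wave BCS trial state** on the
fermionic torus `(ℤ/Lℤ)²` with `N` electrons:
`projectedBCSState g Δv μ L N = normalise (P_g P_N Π_k (u_k + v_k c†_{k↑} c†_{-k↓}) |0⟩)`,
`P_N` the projection on `N` particles, `P_g = Π_r [1 - (1 - g) n_{r↑} n_{r↓}] = g^{#doublons}`
(`g = 0`: Anderson's RVB = the fully Gutzwiller-projected `d`-wave BCS state of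
Paramekanti–Randeria–Trivedi without the `e^{-iS}` dressing; `g = 1`: the number-projected `d`-wave
BCS state; `0 < g < 1`: Laughlin's gossamer states), `u_k, v_k` the `d`-wave coherence factors
`ProjectedBCS.cohU/cohV` at parameters `(Δv, μ)`, normalised by `fockNormalize` (junk `0` if the raw
vector vanishes, e.g. for odd `N`). Definitionally the `let`-chain of the route ProjectedBCSGas
(`projectedBCSState_eq`). [Paramekanti–Randeria–Trivedi 2004, §IV eq. (6), footnote 31, p. 5;
Gros 1989; Zhang–Gros–Rice–Shiba 1988] [cite: ParamekantiRanderiaTrivedi2004, §IV eq. (6)] -/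
def projectedBCSState (g Δv μ : ℝ) (L N : ℕ) : Fock (Orb (FermionTorus 2 L)) :=
  fockNormalize fun s => projWeight g N s * ProjectedBCS.bcsState L Δv μ s

/-- `projectedBCSState` is, by `rfl`, the term inlined in the route decls of
`Summits/…/Theses/ProjectedBCSGas.lean` (there with `N := 2 * ⌊(1 - δ) * (L : ℝ) ^ 2 / 2⌋₊` and
under `open scoped Classical`, which is why the doublon filter carries the classical instance).
Use it (or `change` / `Iff.rfl`) to rewrite those decls to the named form.
[Paramekanti–Randeria–Trivedi 2004, §IV eq. (6)] [cite: ParamekantiRanderiaTrivedi2004, §IV eq. (6)] -/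
theorem projectedBCSState_eq (g Δv μ : ℝ) (L N : ℕ) :
    projectedBCSState g Δv μ L N =
      (let kc : FermionTorus 2 L → Fin 2 → ℝ := fun n i =>
          Real.cos (2 * Real.pi * ((ofLex n i : ℕ) : ℝ) / L)
        let ξ : FermionTorus 2 L → ℝ := fun n => -2 * (kc n 0 + kc n 1) - μ
        let Δ : FermionTorus 2 L → ℝ := fun n => Δv * (kc n 0 - kc n 1)
        let E : FermionTorus 2 L → ℝ := fun n => Real.sqrt (ξ n ^ 2 + Δ n ^ 2)
        let u : FermionTorus 2 L → ℝ := fun n => Real.sqrt ((1 + ξ n / E n) / 2)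
        let v : FermionTorus 2 L → ℝ := fun n =>
          (if 0 ≤ Δ n then 1 else -1) * Real.sqrt ((1 - ξ n / E n) / 2)
        let θ : FermionTorus 2 L → FermionTorus 2 L → ℝ := fun n x =>
          2 * Real.pi * (((ofLex n 0 : ℕ) * (ofLex x 0 : ℕ) + (ofLex n 1 : ℕ) * (ofLex x 1 : ℕ) : ℕ) : ℝ) / L
        let b : FermionTorus 2 L →
            Matrix (Finset (Orb (FermionTorus 2 L))) (Finset (Orb (FermionTorus 2 L))) ℂ := fun n =>
          ∑ x : FermionTorus 2 L, ∑ y : FermionTorus 2 L,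
            (Complex.exp (Complex.I * ((θ n x - θ n y : ℝ) : ℂ)) / (L : ℂ) ^ 2) •
              (creation (orb x 0) * creation (orb y 1))
        let bcs : Fock (Orb (FermionTorus 2 L)) :=
          ((Finset.univ : Finset (FermionTorus 2 L)).toList.map (fun n =>
            ((u n : ℝ) : ℂ) • (1 : Matrix (Finset (Orb (FermionTorus 2 L)))
              (Finset (Orb (FermionTorus 2 L))) ℂ) + ((v n : ℝ) : ℂ) • b n)).prod *ᵥ vacuum
        let raw : Fock (Orb (FermionTorus 2 L)) := fun s =>
          (if s.card = N then
            (g : ℂ) ^ (@Finset.filter _ (fun x : FermionTorus 2 L => orb x 0 ∈ s ∧ orb x 1 ∈ s)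
              (fun _ => Classical.propDecidable _) Finset.univ).card else 0) * bcs s
        (((Real.sqrt ((star raw ⬝ᵥ raw).re))⁻¹ : ℝ) : ℂ) • raw) :=
  rfl

/-- Operator form: `projectedBCSState = normalise (P_g (P_N |BCS⟩))` with the diagonal matrices
`gutzwillerWeight g` and `numberProj N`. [Paramekanti–Randeria–Trivedi 2004, §IV]
[cite: ParamekantiRanderiaTrivedi2004, §IV eq. (6)] -/
theorem projectedBCSState_eq_fockNormalize (g Δv μ : ℝ) (L N : ℕ) :
    projectedBCSState g Δv μ L N =
      fockNormalize (gutzwillerWeight g *ᵥ (numberProj N *ᵥ ProjectedBCS.bcsState L Δv μ)) := by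
  rw [projectedBCSState, projWeight_mul_eq_mulVec]

/-- The `g = 1` member is the normalised number-projected (unprojected) BCS state
`normalise (P_N |BCS⟩)` (the state of the route's `UnprojectedBCSPairLRO`).
[Paramekanti–Randeria–Trivedi 2004, §IV footnote 31] [cite: ParamekantiRanderiaTrivedi2004, §IV footnote 31] -/
theorem projectedBCSState_one_eq (Δv μ : ℝ) (L N : ℕ) :
    projectedBCSState 1 Δv μ L N =
      fockNormalize (numberProj N *ᵥ ProjectedBCS.bcsState L Δv μ) := by
  rw [projectedBCSState_eq_fockNormalize, gutzwillerWeight_one_mulVec]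

/-- The `g = 0` member is the normalised FULLY Gutzwiller-projected, number-projected BCS state
`normalise (P_G P_N |BCS⟩)` (Anderson's RVB state; `gutzwillerProj` of `NagaokaTasaki`).
[Paramekanti–Randeria–Trivedi 2004, §IV eq. (6) (`P |Ψ_BCS⟩`)] [cite: ParamekantiRanderiaTrivedi2004, §IV eq. (6)] -/
theorem projectedBCSState_zero_eq (Δv μ : ℝ) (L N : ℕ) :
    projectedBCSState 0 Δv μ L N =
      fockNormalize (gutzwillerProj *ᵥ (numberProj N *ᵥ ProjectedBCS.bcsState L Δv μ)) := by
  rw [projectedBCSState_eq_fockNormalize, gutzwillerWeight_zero]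

/-- Components of the projected state. [folklore] -/
theorem projectedBCSState_apply (g Δv μ : ℝ) (L N : ℕ) (s : Finset (Orb (FermionTorus 2 L))) :
    projectedBCSState g Δv μ L N s =
      (((Real.sqrt ((star (fun s => projWeight g N s * ProjectedBCS.bcsState L Δv μ s) ⬝ᵥ
          (fun s => projWeight g N s * ProjectedBCS.bcsState L Δv μ s)).re))⁻¹ : ℝ) : ℂ) *
        (projWeight g N s * ProjectedBCS.bcsState L Δv μ s) := rfl

/-- The projected state has exactly `N` particles (`P_N`). [Paramekanti–Randeria–Trivedi 2004,
§IV (an `N`-electron state)] [cite: ParamekantiRanderiaTrivedi2004, §IV eq. (6)] -/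
theorem isNParticle_projectedBCSState (g Δv μ : ℝ) (L N : ℕ) :
    IsNParticle N (projectedBCSState g Δv μ L N) := fun s hs => by
  rw [projectedBCSState_apply, projWeight, if_neg hs, zero_mul, mul_zero]

/-- The projected state is spin-balanced (every pair carries one up and one down spin; the
diagonal projections do not enlarge the support). [folklore] -/
theorem projectedBCSState_mem_spinBalanced (g Δv μ : ℝ) (L N : ℕ) :
    projectedBCSState g Δv μ L N ∈ spinBalanced :=
  mem_spinBalanced_of_support (ProjectedBCS.bcsState_mem_spinBalanced L Δv μ) fun s hs => by
    rw [projectedBCSState_apply, hs, mul_zero, mul_zero]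

/-- The projected state has `S^z = 0`. [Paramekanti–Randeria–Trivedi 2004, §IV (singlet pairs
`c†_{k↑} c†_{-k↓}`)] [cite: ParamekantiRanderiaTrivedi2004, §IV eq. (6)] -/
theorem spinZ_mulVec_projectedBCSState (g Δv μ : ℝ) (L N : ℕ) :
    HubbardWave0.spinZ *ᵥ projectedBCSState g Δv μ L N = 0 :=
  spinZ_mulVec_eq_zero_of_mem_spinBalanced (projectedBCSState_mem_spinBalanced g Δv μ L N)

/-- The projected state lies in the joint sector `(N, S^z = 0)` of `HubbardModel.szSector` (the
sector of `IsGroundStateInSector … N 0` in the route's `RVBShadowing`). [folklore] -/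
theorem projectedBCSState_mem_szSector (g Δv μ : ℝ) (L N : ℕ) :
    projectedBCSState g Δv μ L N ∈ szSector N 0 := by
  rw [mem_szSector_iff]
  refine ⟨isNParticle_projectedBCSState g Δv μ L N, ?_⟩
  rw [spinZ_mulVec_projectedBCSState, Complex.ofReal_zero, zero_smul]

/-- At `g = 0` the state obeys the Gutzwiller constraint (full projection: no doubly occupied
site carries amplitude). [Paramekanti–Randeria–Trivedi 2004, §IV (`P = Π_r (1 - n_{r↑} n_{r↓})`
"eliminates all doubly occupied sites")] [cite: ParamekantiRanderiaTrivedi2004, §IV eq. (6)] -/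
theorem isGutzwiller_projectedBCSState_zero (Δv μ : ℝ) (L N : ℕ) :
    IsGutzwiller (projectedBCSState 0 Δv μ L N) := by
  intro s hs
  have hD : doublonCount s ≠ 0 := mt (doublonCount_eq_zero_iff s).1 (not_not.2 hs)
  rw [projectedBCSState_apply, projWeight, Complex.ofReal_zero, zero_pow hD, ite_self, zero_mul,
    mul_zero]

/-- Equivalently, at `g = 0` the state is fixed by the Gutzwiller projector. [folklore] -/
theorem gutzwillerProj_mulVec_projectedBCSState_zero (Δv μ : ℝ) (L N : ℕ) :
    gutzwillerProj *ᵥ projectedBCSState 0 Δv μ L N = projectedBCSState 0 Δv μ L N :=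
  (gutzwillerProj_mulVec_eq_self_iff _).2 (isGutzwiller_projectedBCSState_zero Δv μ L N)

/-- The projected state is a unit vector whenever the raw vector `P_g P_N |BCS⟩` is nonzero.
[folklore] -/
theorem star_projectedBCSState_dotProduct {g Δv μ : ℝ} {L N : ℕ}
    (h : (fun s => projWeight g N s * ProjectedBCS.bcsState L Δv μ s) ≠ 0) :
    star (projectedBCSState g Δv μ L N) ⬝ᵥ projectedBCSState g Δv μ L N = 1 :=
  star_fockNormalize_dotProduct h

end Literature.MathematicalPhysics.QuantumLattice
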